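import Literature.NumberTheory.Transcendental.QuadraticRelationsLogarithmsSec4Projection
import HarnessLib

/-!
# Roy–Waldschmidt 1997, §4: the linear core of the proof of Théorème 4.1 (steps 4–8)

D. Roy, M. Waldschmidt, *Approximation diophantienne et indépendance algébrique de logarithmes*,
Ann. Sci. ÉNS (4) 30 (1997) 753–796, §4, "Démonstration du théorème 4.1", pp. 776–779.

Théorème 4.1 (p. 772) lifts the obstruction subgroup `H = H₀ × H₁` produced by Théorème 2.1 for
the *reduced* data (at a place `𝔭` of degree `D` of the function field `K`) to an algebraic subgroup
`L = L₀ × H₁` of `G = 𝔾ₐ^{d₀} × 𝔾ₘ^{d₁}` defined over `K`.  Its proof has an algebro-geometric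
part — steps 1–3 (the decomposition `H = H₀ × H₁`, Lemme 4.8 on the character lattice of `H₁`,
the set `E = {π₀(γ) ; γ ∈ Σ', π₀(γ)‾ ∈ H₀(κ)}`), which lives in the vocabulary of Théorème 2.1 —
and a purely linear part, steps 4–8 (pp. 777–779), which takes place in `K^d`, `κ^d`
(`d = d₀ + d₁`) and in the function-field heights of §4, and constructs the `K`-subspace
`R = L₀(K) ⊆ K^{d₀}`:

> "8) En vertu de 7), il suffit, pour conclure, de montrer l'existence d'un sous-espace `R` de
> `K^{d₀}`, de même dimension sur `K` que `H₀(κ)` sur `κ`, qui contient `E` et qui vérifie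
> `dim_K(V₁ ∩ R) ≥ dim_κ(V̄₁ ∩ H₀(κ))`. On définira alors `L₀` comme étant le sous-groupe
> algébrique de `𝔾ₐ^{d₀}` défini sur `K` pour lequel `L₀(K) = R`."

This file proves that linear part as one statement, **`thm_4_1_linear_core`**, in the rendering of
the sibling files (`…Sec4Heights`, `…Sec4Regular`, `…Sec4Subspaces`, `…Sec4Projection`):
given integral vectors `w₁, …, w_{ℓ₀} ∈ 𝒪^{d₀+d₁}` (`K`-free, spanning `W`), a subspace
`T₁ ⊆ K^{d₁}` with a basis of vectors with coordinates algebraic over `k` (`T_{H₁}(K)`, `H₁` being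
defined over `ℚ`), a subspace `S₀ ⊆ κ^{d₀}` (`H₀(κ)`), a finite family `E ⊆ 𝒪^{d₀}` whose
reductions lie in `S₀`, and the height condition `∑ⱼ h₁(wⱼ) + d₀ · B_E < D` where `h₁(e) ≤ B_E`
on `E` (the paper's `D > 2d₀ log B₁ + ℓ₀ log B₂` with `h₁(wⱼ) ≤ log B₂`, `h₁(e) ≤ 2 log B₁`), there
is `R ⊆ K^{d₀}` with `R̄ = S₀`, `dim_K R = dim_κ S₀`, `E ⊆ R`, and the inequality (4.5)
`dim_K(W ∩ (R × T₁)) ≥ dim_κ(W̄ ∩ (S₀ × T̄₁))` (from which condition (iii) of Théorème 4.1 follows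
with `dim_κ W̄ = dim_K W`, step 5), together with `W̄ = span(w̄ⱼ)` (step 4).  The proof is the
printed one: step 4 (`isRegularBasis_of_sum_affHeight_lt`), step 6 (Lemme 4.5 with
`h(K^{d₀} × T₁) = 0`), step 7 (Lemme 4.5 with `h(0 × K^{d₁}) = 0`, Lemme 4.6 for `π₀`, two
rank–nullity counts), step 8 (a regular basis of `V₂ = span E` extracted from `E`, Lemme 4.5,
Lemme 4.7).

Also: `reduction_span_eq_of_isAlgebraic` (a `K`-free family with `k`-algebraic coordinates is a
regular basis of its span, so its reduction is spanned by the reduced vectors — the identification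
`T_{H₁}(κ) = T_{H₁}(K)‾` needed to read (4.5)).

Everything is proved; no named facts are introduced.

## Index of the §4 files (paper ↔ Lean)

* p. 772 `ord_q(x)`, `h(x₀ : … : xₙ)`, `h₁` — `ordVec`, `projHeight`, `affHeight` (`…Sec4Heights`);
  product formula `projHeight_smul`; `h₁` arithmetic `affHeight_mul_le`, `_add_le`, `_inv`,
  `_zpow_le`, `_prod_zpow_le`, `_det_le`, `_minors_le` (`…Sec4Projection`).
* p. 773 Lemme 4.2 — `lemme_4_2`, `ord_eq_zero_of_affHeight_lt_degree` (`…Sec4Heights`).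
* p. 773 `x̄`, `V̄`, `V ∩ 𝒪ⁿ` — `redVec`, `reduction`, `integralPoints`; Lemme 4.3 —
  `finrank_reduction`, `IsRegularBasis` (+ `.linearIndependent_int/.span_int_eq/.span_eq`,
  `.ordVec_minors_eq_zero`, `isRegularBasis_of_basis_int`, `isRegularBasis_of_ordVec_minors_eq_zero`);
  `x₁ ∧ ⋯ ∧ x_m` — `minors`; Lemme 4.4 — `lemme_4_4`, `lemme_4_4_of_card_eq`,
  `exists_isRegularBasis` (`…Sec4Regular`).
* p. 773 `h(V)` — `subspaceHeight`, `subspaceHeight_eq`, `_eq_zero_of_isAlgebraic`; Lemme 4.5 —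
  `lemme_4_5`, `lemme_4_5_reduction` (`…Sec4Subspaces`).
* p. 775 Lemme 4.6 — `lemme_4_6_height`, `lemme_4_6_reduction`; Lemme 4.7 — `lemme_4_7`; steps 4/8
  of Théorème 4.1 — `isRegularBasis_of_sum_affHeight_lt`, `isRegularBasis_of_affHeight_minors_lt`,
  `subspaceHeight_le_sum_affHeight` (`…Sec4Projection`).
* pp. 777–779 steps 4–8 — `thm_4_1_linear_core`, `finrank_sup_add_le_of_finrank_inf_le` ((4.5) ⇒
  (iii)), `reduction_span_eq_of_isAlgebraic` (`T_{H₁}(K)‾ = T_{H₁}(κ)`) (this file).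
* Not formalized here: Lemme 4.8 (character lattice of `H₁`, Mahler's basis theorem) and steps 1–3
  / the final packaging of Théorème 4.1, which use the objects of Théorème 2.1.

## References

* [RoyWaldschmidt1997ENS] D. Roy, M. Waldschmidt, Ann. Sci. ÉNS (4) 30 (1997) 753–796, §4,
  Théorème 4.1 p. 772 and its proof, steps 4–8, pp. 777–779.
-/

noncomputable section

open scoped Classical

namespace Literature.NumberTheory.Transcendental

namespace RoyWaldschmidt1997

open Literature.NumberTheory.DiophantineGeometry
open Literature.NumberTheory.DiophantineGeometry.AlgFunctionField

universe u v

variable {k : Type u} {K : Type v} [Field k] [Field K] [Algebra k K]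

open Module Submodule

variable (p : PlaceOver k K)

omit [Field K] [Algebra k K] in
/-- `funLeft f v = v ∘ f` (function form). [folklore] -/
theorem funLeft_apply_fun {F : Type*} [Semiring F] {m n : Type*} (f : m → n) (v : n → F) :
    LinearMap.funLeft F F f v = v ∘ f := rfl

/-! ### Algebraic (in particular rational) bases are regular -/

/-- A `K`-free family of vectors with coordinates algebraic over `k` consists of integral vectors
forming a **regular basis of its span at every place** (its nonzero Plücker coordinates are
algebraic, hence units). [cite: RoyWaldschmidt1997ENS, Lemme 4.3, p. 773] -/
theorem isRegularBasis_of_isAlgebraic [IsAlgFunctionField k K] {n r : Type*} [Fintype n]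
    [Fintype r] [DecidableEq r] {t : r → n → K} (hli : LinearIndependent K t)
    (halg : ∀ i j, IsAlgebraic k (t i j)) :
    ∃ tO : r → n → p.toValuationSubring, (∀ i, inclVec p (tO i) = t i) ∧
      IsRegularBasis p (span K (Set.range t)) tO := by
  have hmem : ∀ i j, t i j ∈ p.toValuationSubring := fun i j ↦
    IsAlgFunctionField.mem_valuationSubring_of_isAlgebraic _ p.algebraMap_mem (halg i j)
  set tO : r → n → p.toValuationSubring := fun i j ↦ ⟨t i j, hmem i j⟩ with htO
  have hincl : ∀ i, inclVec p (tO i) = t i := fun i ↦ rfl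
  have hfam : (fun i ↦ inclVec p (tO i)) = t := funext hincl
  refine ⟨tO, hincl, ?_⟩
  have hvec : (fun f : r → n ↦ ((minors tO f : p.toValuationSubring) : K)) = minors t := by
    rw [← hfam]; exact funext fun f ↦ (minors_inclVec_eq p tO f).symm
  have hne : minors t ≠ 0 := by
    obtain ⟨f, hf⟩ := exists_minors_ne_zero hli
    exact fun h0 ↦ hf (congr_fun h0 f)
  have h := isRegularBasis_of_ordVec_minors_eq_zero (p := p) (V := span K (Set.range t))
    (x := tO) (fun i ↦ (mem_integralPoints p).2 (by rw [hincl]; exact subset_span ⟨i, rfl⟩))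
    (by rw [finrank_span_eq_card hli]) (by rw [hvec]; exact hne) (by
      rw [hvec]
      obtain ⟨f, hf, hqf⟩ := exists_ordVec_eq p hne
      rw [hqf]
      exact p.ord_eq_zero_of_isAlgebraic hf (isAlgebraic_minors halg f))
  exact h

/-- Hence the reduction of the span of such a family is the span of the reduced vectors
(`T_{H₁}(K)‾ = T_{H₁}(κ)` for `H₁` defined over `ℚ`). [cite: RoyWaldschmidt1997ENS, §4, p. 778] -/
theorem reduction_span_eq_of_isAlgebraic [IsAlgFunctionField k K] {n r : Type*} [Fintype n]
    [Fintype r] [DecidableEq r] {t : r → n → K} (hli : LinearIndependent K t)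
    (halg : ∀ i j, IsAlgebraic k (t i j)) :
    ∃ tO : r → n → p.toValuationSubring, (∀ i, inclVec p (tO i) = t i) ∧
      reduction p (span K (Set.range t)) = span p.residueField (Set.range fun i ↦ redVec p (tO i)) := by
  obtain ⟨tO, htO, hreg⟩ := isRegularBasis_of_isAlgebraic p hli halg
  exact ⟨tO, htO, hreg.span_red.symm⟩

/-! ### Cylinders over a block of coordinates -/

section Cylinder

variable {d₀ d₁ : Type*} [Fintype d₀] [Fintype d₁]

omit [Fintype d₀] [Fintype d₁] in
/-- **Reduction of a cylinder**: `(K^{d₀} × T₁)‾ = κ^{d₀} × T̄₁` (step 6: "`V̄ = W̄ ∩ (κ^{d₀} × T_{H₁}(κ))`"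
uses this reading of `A^{d₀} × T_{H₁}`). [cite: RoyWaldschmidt1997ENS, §4, p. 778] -/
theorem reduction_comap_funLeft_inr (T₁ : Submodule K (d₁ → K)) :
    reduction p (T₁.comap (LinearMap.funLeft K K (Sum.inr : d₁ → d₀ ⊕ d₁))) =
      (reduction p T₁).comap
        (LinearMap.funLeft p.residueField p.residueField (Sum.inr : d₁ → d₀ ⊕ d₁)) := by
  ext y
  rw [mem_reduction_iff, Submodule.mem_comap, funLeft_apply_fun, mem_reduction_iff]
  constructor
  · rintro ⟨x, hx, rfl⟩
    rw [mem_integralPoints, Submodule.mem_comap, funLeft_apply_fun] at hx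
    exact ⟨x ∘ Sum.inr, (mem_integralPoints p).2 hx, rfl⟩
  · rintro ⟨z, hz, hzy⟩
    obtain ⟨x₀, hx₀⟩ := redVec_surjective p (y ∘ Sum.inl)
    refine ⟨Sum.elim x₀ z, ?_, ?_⟩
    · rw [mem_integralPoints, Submodule.mem_comap, funLeft_apply_fun]
      have : inclVec p (Sum.elim x₀ z) ∘ Sum.inr = inclVec p z := by funext i; rfl
      rw [this]; exact (mem_integralPoints p).1 hz
    · funext i
      rcases i with i | i
      · exact congr_fun hx₀ i
      · exact congr_fun hzy i

omit [Fintype d₀] [Fintype d₁] in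
/-- Likewise `(R × K^{d₁})`-type cylinders: `comap π₀` of a subspace. [folklore] -/
theorem reduction_comap_funLeft_inl (R : Submodule K (d₀ → K)) :
    reduction p (R.comap (LinearMap.funLeft K K (Sum.inl : d₀ → d₀ ⊕ d₁))) =
      (reduction p R).comap
        (LinearMap.funLeft p.residueField p.residueField (Sum.inl : d₀ → d₀ ⊕ d₁)) := by
  ext y
  rw [mem_reduction_iff, Submodule.mem_comap, funLeft_apply_fun, mem_reduction_iff]
  constructor
  · rintro ⟨x, hx, rfl⟩
    rw [mem_integralPoints, Submodule.mem_comap, funLeft_apply_fun] at hx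
    exact ⟨x ∘ Sum.inl, (mem_integralPoints p).2 hx, rfl⟩
  · rintro ⟨z, hz, hzy⟩
    obtain ⟨x₁, hx₁⟩ := redVec_surjective p (y ∘ Sum.inr)
    refine ⟨Sum.elim z x₁, ?_, ?_⟩
    · rw [mem_integralPoints, Submodule.mem_comap, funLeft_apply_fun]
      have : inclVec p (Sum.elim z x₁) ∘ Sum.inl = inclVec p z := by funext i; rfl
      rw [this]; exact (mem_integralPoints p).1 hz
    · funext i
      rcases i with i | i
      · exact congr_fun hzy i
      · exact congr_fun hx₁ i

/-- **`h(K^{d₀} × T₁) = 0` when `T₁` has a `k`-algebraic basis** ("`h(A^{d₀} × T_{H₁}(K)) = 0` car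
`A^{d₀} × T_{H₁}(K)` est un sous-espace de `K^d` défini sur `ℚ`", step 6).
[cite: RoyWaldschmidt1997ENS, §4, p. 778] -/
theorem subspaceHeight_comap_funLeft_inr_eq_zero [IsAlgFunctionField k K] [DecidableEq d₀]
    [DecidableEq d₁] {T₁ : Submodule K (d₁ → K)} {s : ℕ} {t : Fin s → d₁ → K}
    (hli : LinearIndependent K t) (hspan : span K (Set.range t) = T₁)
    (halg : ∀ i j, IsAlgebraic k (t i j)) :
    subspaceHeight k (T₁.comap (LinearMap.funLeft K K (Sum.inr : d₁ → d₀ ⊕ d₁))) = 0 := by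
  -- the basis: standard vectors on `d₀`, and `(0, t_l)`
  set b : d₀ ⊕ Fin s → d₀ ⊕ d₁ → K :=
    Sum.elim (fun i ↦ Pi.single (Sum.inl i) 1) (fun l ↦ Sum.elim (0 : d₀ → K) (t l)) with hb
  have hb_inl : ∀ i, b (Sum.inl i) = Pi.single (Sum.inl i) 1 := fun i ↦ rfl
  have hb_inr : ∀ l, b (Sum.inr l) = Sum.elim (0 : d₀ → K) (t l) := fun l ↦ rfl
  refine subspaceHeight_eq_zero_of_isAlgebraic (x := b) ?_ ?_ ?_
  · -- independence
    rw [Fintype.linearIndependent_iff]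
    intro c hc
    rw [Fintype.sum_sum_type] at hc
    have h1 : ∀ i : d₀, c (Sum.inl i) = 0 := by
      intro i
      have := congr_fun hc (Sum.inl i)
      simp only [Pi.add_apply, Finset.sum_apply, Pi.smul_apply, hb_inl, hb_inr, Sum.elim_inl,
        Pi.zero_apply, Finset.sum_const_zero, add_zero, Pi.single_apply,
        Sum.inl.injEq, smul_eq_mul, mul_ite, mul_one, mul_zero,
        Finset.sum_ite_eq, Finset.mem_univ, if_true] at this
      exact this
    have h2 : ∑ l, c (Sum.inr l) • t l = 0 := by
      funext j
      have := congr_fun hc (Sum.inr j)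
      simp only [Pi.add_apply, Finset.sum_apply, Pi.smul_apply, hb_inl, hb_inr, Sum.elim_inr,
        Pi.zero_apply, Pi.single_apply, smul_eq_mul] at this
      simp only [reduceCtorEq, if_false, mul_zero, Finset.sum_const_zero, zero_add] at this
      simpa [Finset.sum_apply, Pi.smul_apply, smul_eq_mul] using this
    have h3 := Fintype.linearIndependent_iff.1 hli _ h2
    rintro (i | l)
    · exact h1 i
    · exact h3 l
  · -- span
    refine le_antisymm (span_le.2 ?_) fun v hv ↦ ?_
    · rintro _ ⟨i | l, rfl⟩
      · rw [SetLike.mem_coe, Submodule.mem_comap, funLeft_apply_fun, hb_inl]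
        have : (Pi.single (Sum.inl i) (1 : K) : d₀ ⊕ d₁ → K) ∘ Sum.inr = 0 := by
          funext j; simp
        rw [this]; exact zero_mem _
      · rw [SetLike.mem_coe, Submodule.mem_comap, funLeft_apply_fun, hb_inr, ← hspan]
        exact subset_span ⟨l, rfl⟩
    · rw [Submodule.mem_comap, funLeft_apply_fun, ← hspan] at hv
      obtain ⟨c, hc⟩ := (Submodule.mem_span_range_iff_exists_fun K).1 hv
      have hv_eq : v = ∑ i, v (Sum.inl i) • b (Sum.inl i) + ∑ l, c l • b (Sum.inr l) := by
        funext j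
        rcases j with j | j
        · simp [Finset.sum_apply, hb_inl, hb_inr, Pi.single_apply]
        · have := congr_fun hc j
          simp only [Finset.sum_apply, Pi.smul_apply, smul_eq_mul] at this
          simp [Finset.sum_apply, hb_inl, hb_inr, this]
      rw [hv_eq]
      exact add_mem (sum_mem fun i _ ↦ smul_mem _ _ (subset_span ⟨Sum.inl i, rfl⟩))
        (sum_mem fun l _ ↦ smul_mem _ _ (subset_span ⟨Sum.inr l, rfl⟩))
  · -- algebraic coordinates
    rintro (i | l) j
    · rw [hb_inl, Pi.single_apply]
      split_ifs
      · exact isAlgebraic_one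
      · exact isAlgebraic_zero
    · rw [hb_inr]
      rcases j with j | j
      · exact isAlgebraic_zero
      · exact halg l j

end Cylinder

/-! ### Two lattice identities -/

omit [Field K] [Algebra k K] in
/-- `f(V ∩ f⁻¹(Q)) = f(V) ∩ Q`. [folklore] -/
theorem map_inf_comap_eq {F M M₂ : Type*} [Field F] [AddCommGroup M] [Module F M]
    [AddCommGroup M₂] [Module F M₂] (f : M →ₗ[F] M₂) (V : Submodule F M) (Q : Submodule F M₂) :
    (V ⊓ Q.comap f).map f = V.map f ⊓ Q := by
  refine le_antisymm (le_inf (map_mono inf_le_left) (map_le_iff_le_comap.2 inf_le_right)) ?_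
  rintro _ ⟨⟨x, hx, rfl⟩, hq⟩
  exact ⟨x, ⟨hx, hq⟩, rfl⟩

omit [Field K] [Algebra k K] in
/-- `dim (V ∩ f⁻¹(Q)) = dim (V ∩ ker f) + dim (f(V) ∩ Q)` (the exact sequences of step 7).
[cite: RoyWaldschmidt1997ENS, §4, p. 778] -/
theorem finrank_inf_comap_eq {F M M₂ : Type*} [Field F] [AddCommGroup M] [Module F M]
    [AddCommGroup M₂] [Module F M₂] [FiniteDimensional F M] (f : M →ₗ[F] M₂) (V : Submodule F M)
    (Q : Submodule F M₂) :
    finrank F ↥(V ⊓ Q.comap f) = finrank F ↥(V ⊓ LinearMap.ker f) + finrank F ↥(V.map f ⊓ Q) := by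
  have h := finrank_map_add_finrank_inf_ker_of_field f (V ⊓ Q.comap f)
  rw [map_inf_comap_eq] at h
  have hker : V ⊓ Q.comap f ⊓ LinearMap.ker f = V ⊓ LinearMap.ker f := by
    refine le_antisymm (le_inf (inf_le_left.trans inf_le_left) inf_le_right) ?_
    refine le_inf (le_inf inf_le_left fun x hx ↦ ?_) inf_le_right
    rw [Submodule.mem_comap, LinearMap.mem_ker.1 hx.2]
    exact zero_mem _
  rw [hker] at h
  omega

omit [Field K] [Algebra k K] in
/-- **From (4.5) to condition (iii) of Théorème 4.1** ("La condition (iii) sera donc remplie si on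
choisit `L₀` de telle sorte que (4.5)", step 5): with `dim_κ W̄ = dim_K W`,
`dim_κ(W̄ ∩ T_H) ≤ dim_K(W ∩ T_L)` gives `dim_K((W + T_L)/T_L) ≤ dim_κ((W̄ + T_H)/T_H)`, written
additively as `dim(W + T_L) + dim T_H ≤ dim(W̄ + T_H) + dim T_L`.
[cite: RoyWaldschmidt1997ENS, §4, p. 778] -/
theorem finrank_sup_add_le_of_finrank_inf_le {F₁ M₁ F₂ M₂ : Type*} [Field F₁] [AddCommGroup M₁]
    [Module F₁ M₁] [FiniteDimensional F₁ M₁] [Field F₂] [AddCommGroup M₂] [Module F₂ M₂]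
    [FiniteDimensional F₂ M₂] (W TL : Submodule F₁ M₁) (Wb TH : Submodule F₂ M₂)
    (hW : finrank F₂ Wb = finrank F₁ W) (h : finrank F₂ ↥(Wb ⊓ TH) ≤ finrank F₁ ↥(W ⊓ TL)) :
    finrank F₁ ↥(W ⊔ TL) + finrank F₂ TH ≤ finrank F₂ ↥(Wb ⊔ TH) + finrank F₁ TL := by
  have h1 := Submodule.finrank_sup_add_finrank_inf_eq W TL
  have h2 := Submodule.finrank_sup_add_finrank_inf_eq Wb TH
  omega

/-! ### The linear core of Théorème 4.1 -/

section Core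

variable {d₀ d₁ : Type*} [Fintype d₀] [Fintype d₁] [DecidableEq d₀] [DecidableEq d₁]

/-- **Roy–Waldschmidt, proof of Théorème 4.1, steps 4–8 (the linear part).**  Let `𝔭` be a place
of degree `D` of the function field `K/k`, `d = d₀ + d₁`, and let

* `w₁, …, w_{ℓ₀} ∈ 𝒪^d` be `K`-linearly independent, spanning `W ⊆ K^d`;
* `T₁ ⊆ K^{d₁}` be spanned by a `K`-free family `t` with coordinates algebraic over `k`
  (the tangent space `T_{H₁}(K)` of a subtorus defined over `ℚ`);
* `S₀ ⊆ κ^{d₀}` be a subspace (the vector part `H₀(κ)` of the obstruction subgroup);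
* `E = (eᵢ)` be a finite family in `𝒪^{d₀}` whose reductions `ēᵢ` lie in `S₀`;
* `h₁(eᵢ) ≤ B_E` for all `i`, and `∑ⱼ h₁(wⱼ) + d₀ · B_E < D` (the paper's
  `D > 2d₀ log B₁ + ℓ₀ log B₂`).

Then there is a subspace `R ⊆ K^{d₀}` with `R̄ = S₀`, `dim_K R = dim_κ S₀`, `E ⊆ R`, and
`dim_K(W ∩ (R × T₁)) ≥ dim_κ(W̄ ∩ (S₀ × T̄₁))` — inequality (4.5), from which condition (iii) of
Théorème 4.1 follows for `L = L₀ × H₁`, `L₀(K) = R`, using `dim_κ W̄ = dim_K W`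
(`finrank_reduction`) — and moreover `W̄` is spanned by the `w̄ⱼ` (step 4).  Here
`R × T₁ = π₀⁻¹(R) ∩ π₁⁻¹(T₁)` and `S₀ × T̄₁ = π̄₀⁻¹(S₀) ∩ π̄₁⁻¹(T̄₁)` with `π₀, π₁` the two coordinate
projections (`LinearMap.funLeft … Sum.inl/Sum.inr`) and `T̄₁ = T₁‾` (= the `κ`-span of `t̄`,
`reduction_span_eq_of_isAlgebraic`). [cite: RoyWaldschmidt1997ENS, Théorème 4.1 (proof, steps 4–8), pp. 777–779] -/
theorem thm_4_1_linear_core [IsAlgFunctionField k K] {ℓ₀ : ℕ}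
    {w : Fin ℓ₀ → d₀ ⊕ d₁ → p.toValuationSubring}
    (hw : LinearIndependent K fun j ↦ inclVec p (w j))
    {T₁ : Submodule K (d₁ → K)} {s : ℕ} {t : Fin s → d₁ → K} (ht : LinearIndependent K t)
    (htspan : span K (Set.range t) = T₁) (htalg : ∀ i j, IsAlgebraic k (t i j))
    (S₀ : Submodule p.residueField (d₀ → p.residueField))
    {ι : Type*} [Fintype ι] {e : ι → d₀ → p.toValuationSubring} (heS : ∀ i, redVec p (e i) ∈ S₀)
    {B : ℤ} (hB : 0 ≤ B) (heB : ∀ i, affHeight k (inclVec p (e i)) ≤ B)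
    (hD : ∑ j, affHeight k (inclVec p (w j)) + Fintype.card d₀ * B < p.degree) :
    ∃ R : Submodule K (d₀ → K),
      reduction p R = S₀ ∧ finrank K R = finrank p.residueField S₀ ∧
      (∀ i, inclVec p (e i) ∈ R) ∧
      finrank p.residueField
          ↥(reduction p (span K (Set.range fun j ↦ inclVec p (w j))) ⊓
            (S₀.comap (LinearMap.funLeft p.residueField p.residueField (Sum.inl : d₀ → d₀ ⊕ d₁)) ⊓
              (reduction p T₁).comap
                (LinearMap.funLeft p.residueField p.residueField (Sum.inr : d₁ → d₀ ⊕ d₁)))) ≤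
        finrank K ↥(span K (Set.range fun j ↦ inclVec p (w j)) ⊓
          (R.comap (LinearMap.funLeft K K (Sum.inl : d₀ → d₀ ⊕ d₁)) ⊓
            T₁.comap (LinearMap.funLeft K K (Sum.inr : d₁ → d₀ ⊕ d₁)))) ∧
      reduction p (span K (Set.range fun j ↦ inclVec p (w j))) =
        span p.residueField (Set.range fun j ↦ redVec p (w j)) := by
  -- notation
  set π₀ := LinearMap.funLeft K K (Sum.inl : d₀ → d₀ ⊕ d₁) with hπ₀
  set π₁ := LinearMap.funLeft K K (Sum.inr : d₁ → d₀ ⊕ d₁) with hπ₁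
  set ρ₀ := LinearMap.funLeft p.residueField p.residueField (Sum.inl : d₀ → d₀ ⊕ d₁) with hρ₀
  set ρ₁ := LinearMap.funLeft p.residueField p.residueField (Sum.inr : d₁ → d₀ ⊕ d₁) with hρ₁
  have hinlK : LinearMap.funLeft K K (⇑(Function.Embedding.inl : d₀ ↪ d₀ ⊕ d₁)) = π₀ := rfl
  have hinlκ : LinearMap.funLeft p.residueField p.residueField
      (⇑(Function.Embedding.inl : d₀ ↪ d₀ ⊕ d₁)) = ρ₀ := rfl
  set W := span K (Set.range fun j ↦ inclVec p (w j)) with hW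
  set C₁ := T₁.comap π₁ with hC₁
  have hw0 : 0 ≤ ∑ j, affHeight k (inclVec p (w j)) :=
    Finset.sum_nonneg fun j _ ↦ affHeight_nonneg _
  have hd₀B : (0 : ℤ) ≤ Fintype.card d₀ * B := mul_nonneg (Nat.cast_nonneg _) hB
  -- Step 4: `w` is a regular basis of `W`
  have hsumw : ∑ j, affHeight k (inclVec p (w j)) < p.degree := by linarith
  have hWreg : IsRegularBasis p W w := isRegularBasis_of_sum_affHeight_lt p hw hsumw
  have hWred : reduction p W = span p.residueField (Set.range fun j ↦ redVec p (w j)) :=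
    hWreg.span_red.symm
  have hWh : subspaceHeight k W ≤ ∑ j, affHeight k (inclVec p (w j)) :=
    subspaceHeight_le_sum_affHeight hw rfl
  -- Step 6: `V = W ∩ (K^{d₀} × T₁)`
  have hC₁h : subspaceHeight k C₁ = 0 :=
    subspaceHeight_comap_funLeft_inr_eq_zero (d₀ := d₀) ht htspan htalg
  have hC₁red : reduction p C₁ = (reduction p T₁).comap ρ₁ := reduction_comap_funLeft_inr p T₁
  set V := W ⊓ C₁ with hV
  have hVh : subspaceHeight k V ≤ subspaceHeight k W := by
    have h45 := lemme_4_5 (k := k) W C₁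
    have := subspaceHeight_nonneg (k := k) (W ⊔ C₁)
    rw [hC₁h] at h45
    linarith
  have hVlt : subspaceHeight k V < p.degree := by linarith
  have hVred : reduction p V = reduction p W ⊓ reduction p C₁ :=
    (lemme_4_5_reduction p W C₁ (by rw [hC₁h, add_zero]; linarith)).2
  -- Step 7: `V₁ = π₀(V)`, `V₀ = V ∩ ker π₀`
  set V₁ := V.map π₀ with hV₁
  have hV₁h : subspaceHeight k V₁ ≤ subspaceHeight k V := by
    have h := lemme_4_6_height (k := k) (Function.Embedding.inl : d₀ ↪ d₀ ⊕ d₁) V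
    rwa [hinlK] at h
  have hV₁red : reduction p V₁ = (reduction p V).map ρ₀ := by
    have h := lemme_4_6_reduction p (Function.Embedding.inl : d₀ ↪ d₀ ⊕ d₁) V hVlt
    rwa [hinlK, hinlκ] at h
  have hker : reduction p (V ⊓ LinearMap.ker π₀) = reduction p V ⊓ LinearMap.ker ρ₀ := by
    have h0 : subspaceHeight k (LinearMap.ker π₀) = 0 := by
      rw [← hinlK, ker_funLeft_eq_span]
      exact subspaceHeight_span_single _
    have h := (lemme_4_5_reduction p V (LinearMap.ker π₀) (by rw [h0, add_zero]; exact hVlt)).2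
    rw [h, ← hinlK, reduction_ker_funLeft, hinlκ]
  -- Step 8: `V₂ = span E`, with a regular basis extracted from `E`
  set V₂ := span K (Set.range fun i ↦ inclVec p (e i)) with hV₂
  obtain ⟨sE, hsli, hsmax⟩ := exists_maximal_linearIndepOn K (fun i ↦ inclVec p (e i))
  set x : sE → d₀ → p.toValuationSubring := fun i ↦ e i with hx
  have hxli : LinearIndependent K fun i ↦ inclVec p (x i) := hsli
  have hxspan : span K (Set.range fun i ↦ inclVec p (x i)) = V₂ := by
    refine le_antisymm (span_mono ?_) (span_le.2 ?_)
    · rintro _ ⟨i, rfl⟩; exact ⟨i, rfl⟩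
    · rintro _ ⟨i, rfl⟩
      by_cases hi : i ∈ sE
      · exact subset_span ⟨⟨i, hi⟩, rfl⟩
      · obtain ⟨a, ha, hmem⟩ := hsmax i hi
        have := Submodule.smul_mem _ a⁻¹ hmem
        rw [inv_smul_smul₀ ha, Set.image_eq_range] at this
        exact this
  have hxcard : (Fintype.card sE : ℤ) ≤ Fintype.card d₀ := by
    have h1 := finrank_span_eq_card hxli
    have h2 := Submodule.finrank_le (span K (Set.range fun i ↦ inclVec p (x i)))
    rw [Module.finrank_fintype_fun_eq_card] at h2
    exact_mod_cast h1 ▸ h2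
  have hxsum : ∑ i, affHeight k (inclVec p (x i)) ≤ Fintype.card d₀ * B := by
    calc ∑ i, affHeight k (inclVec p (x i)) ≤ ∑ _i : sE, B := Finset.sum_le_sum fun i _ ↦ heB i
      _ = Fintype.card sE * B := by simp
      _ ≤ Fintype.card d₀ * B := mul_le_mul_of_nonneg_right hxcard hB
  have hxlt : ∑ i, affHeight k (inclVec p (x i)) < p.degree := by linarith
  have hV₂reg : IsRegularBasis p V₂ x := by
    have h := isRegularBasis_of_sum_affHeight_lt p hxli hxlt
    rwa [hxspan] at h
  have hV₂h : subspaceHeight k V₂ ≤ Fintype.card d₀ * B :=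
    (subspaceHeight_le_sum_affHeight hxli hxspan).trans hxsum
  have hV₂red : reduction p V₂ ≤ S₀ := by
    rw [← hV₂reg.span_red, span_le]
    rintro _ ⟨i, rfl⟩
    exact heS i
  -- `Ū = V̄₁ ∩ V̄₂` and Lemme 4.7
  have hU : reduction p (V₁ ⊓ V₂) = reduction p V₁ ⊓ reduction p V₂ :=
    (lemme_4_5_reduction p V₁ V₂ (by linarith)).2
  obtain ⟨R, hRred, hR₁, hR₂⟩ := lemme_4_7 p V₁ V₂ S₀ hU
  have hRdim : finrank K R = finrank p.residueField S₀ := by rw [← hRred, finrank_reduction]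
  have hV₂R : V₂ ≤ R := by
    have h1 : finrank p.residueField ↥(reduction p V₂ ⊓ S₀) = finrank K V₂ := by
      rw [inf_eq_left.2 hV₂red, finrank_reduction]
    rw [h1] at hR₂
    have h3 : V₂ ⊓ R = V₂ := Submodule.eq_of_le_of_finrank_le inf_le_left hR₂
    exact inf_eq_left.1 h3
  refine ⟨R, hRred, hRdim, fun i ↦ hV₂R (subset_span ⟨i, rfl⟩), ?_, hWred⟩
  -- (4.7) ⇒ (4.6) ⇒ (4.5)
  have hK : finrank K ↥(W ⊓ (R.comap π₀ ⊓ C₁)) =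
      finrank K ↥(V ⊓ LinearMap.ker π₀) + finrank K ↥(V₁ ⊓ R) := by
    have : W ⊓ (R.comap π₀ ⊓ C₁) = V ⊓ R.comap π₀ := by
      rw [hV, inf_assoc, inf_comm (R.comap π₀) C₁]
    rw [this, finrank_inf_comap_eq π₀ V R]
  have hκ : finrank p.residueField
      ↥(reduction p W ⊓ (S₀.comap ρ₀ ⊓ (reduction p T₁).comap ρ₁)) =
      finrank p.residueField ↥(reduction p V ⊓ LinearMap.ker ρ₀) +
        finrank p.residueField ↥(reduction p V₁ ⊓ S₀) := by
    have : reduction p W ⊓ (S₀.comap ρ₀ ⊓ (reduction p T₁).comap ρ₁) =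
        reduction p V ⊓ S₀.comap ρ₀ := by
      rw [hVred, hC₁red, inf_assoc, inf_comm (S₀.comap ρ₀) _]
    rw [this, finrank_inf_comap_eq ρ₀ (reduction p V) S₀, hV₁red]
  have h1 : finrank p.residueField ↥(reduction p V ⊓ LinearMap.ker ρ₀) =
      finrank K ↥(V ⊓ LinearMap.ker π₀) := by
    rw [← hker, finrank_reduction]
  rw [hK, hκ, h1]
  exact add_le_add le_rfl hR₁

end Core

end RoyWaldschmidt1997

end Literature.NumberTheory.Transcendental
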